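import Summits.BirchSwinnertonDyer.Rank1Residual.Supersingular.SignedSqueeze
import Summits.BirchSwinnertonDyer.Rank1Residual.Supersingular.SharpFlatRankZeroReal
import Summits.BirchSwinnertonDyer.Rank1Residual.Supersingular.KobayashiSqueezeReal
import HarnessLib

/-!
# X8 (`p = 3`, `a_3 = ±3`), analytic rank `0`: `BSD(E,3) ⟺` the ♯/♭ main conjecture at the pair,
# with Sprung's REAL `L^•` — (P•) discharged, unit normalisation
# (cell `b2b-bsdres`, supersingular family, prover B = unit `b2b-bsdres-additive-p3`, gen 4)

HONEST FRAMING (run/shared/lean/b2b/bsd-rank1-residual/, verbatim in every file): the goal of the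
cell is to DELETE the COMBINATION-SHAPED residual classes of the Birch–Swinnerton-Dyer formula for
ALL analytic-rank `≤ 1` elliptic curves over `ℚ` — "full BSD formula for every rank `≤ 1` curve in
class `C`" assembled STRICTLY from published theorems — so that the rank-`≤ 1` remainder becomes
exactly the CONSTRUCTION-SHAPED classes, which are TYPED (missing-input `Prop`s), NOT attempted.
This is not "finishing BSD". THEOREMS ONLY (no definition, no named fact, nothing about any curve is
asserted); X8 stays CONSTRUCTION-SHAPED; PER PAIR; nothing booked.

## What this file does

Gen 2 proved, on the ABSTRACT datum `SignedDatum W p = (ξ, L, c)` (`Supersingular/SignedSqueeze.lean`,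
p208039), the rank-zero EXACT FORM `BSD(E,p) ⟺ (ξ^•) = (L^•)` granted (K), (P), `p ∤ c` and the
integral Kato divisibility `ξ ∣ L`. Gen 3 put Sprung's ♯/♭ `p`-adic `L`-functions on the REAL side
(`Sprung2017.IsSprungPair`; (P•) PROVED: `L^•(0) = c_• · [0]⁺_f`, `c_♯ = −a_p² + 2a_p + p − 1`,
`c_♭ = 2 − a_p`; on X8 `c_♯ ∈ {−1, −13}`, `c_♭ ∈ {−1, 5}` are `3`-adic units) and gen 4 proved the pair
UNIQUE (`Sprung2017.IsSprungPair.unique`, Sprung 2017 Thm. 1.12). Here the exact form is re-targeted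
to the real `L^•`:

* `exists_units_interpolation_chromaticL` — **unit normalisation**: at an odd good prime `p` with
  `E[p]` irreducible, for the newform `f` of `E`, ANY Sprung pair `(L♯, L♭)` and a colour `•` with
  `p ∤ c_•`, there is `w ∈ ℤ_p^×` such that the datum `(ξ, w · L^•, 1)` satisfies (P) EXACTLY:
  `(w · L^•)(0) = L(E,1)/Ω_E`. Inputs: the theorem (P•) and the period comparison `Ω_E = u · Ω⁺_f`,
  `|u|_p = 1` (named facts `realPeriodRat_eq_unit_mul_plusPeriod(_three)`: Greenberg–Vatsal §3
  Rem. 3.4 + Manin constant; taken as the displayed hypothesis `hΩ`); `w = (c_• u)⁻¹`. Rescaling by a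
  unit does not change the ideal `(L^•)`, so every datum-level theorem of p208039 now applies to the
  real `L^•` with NO interpolation binder and NO sign bookkeeping (`c_• < 0` allowed);
* `bsdp_iff_span_eq_span_chromaticL_of_analyticRank_eq_zero` — **at a rank-`0` pair with integral
  Kato divisibility `ξ ∣ L^•` for Sprung's real `L^•`: `BSD(E,p) ⟺ (ξ) = (L^•)`**, granted (K•) for
  the displayed `ξ` (read: a characteristic power series of `Hom(Sel^•(E/ℚ_∞), ℚ_p/ℤ_p)`; Sprung,
  Adv. Math. 449 (2024) Lemmas 5.5–5.9 — refereed print, but the ♯/♭ SELMER objects are not tree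
  vocabulary: Sprung 2012 Def. 7.9/7.11 define them through the Coleman maps `Col^♯/♭`, and his Open
  Problem 7.22 records that no description by points — the device of Kobayashi's `E^±` used by the
  tree's `Kobayashi2003.signedSelmerLayer` — is known);
* `X8.bsdp_iff_span_eq_span_chromaticL_of_analyticRank_eq_zero` (+ `_of_semistable_`) and
  `X8.span_eq_span_chromaticL_of_bsdp_of_analyticRank_eq_zero`: on X8 ∧ `r_an = 0` ∧ surj(3) every
  side input is automatic or a named PUBLISHED fact — `p ∤ c_•` for BOTH colours
  (`ClassX8.not_dvd_chromaticConst'`), `E[3]` irreducible (`ClassX8.irr'`), the period unit at `p = 3`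
  (`realPeriodRat_eq_unit_mul_plusPeriod_three`, Mazur 1978 Cor. 4.1 + GV Rem. 3.4), the image
  hypothesis of Sprung 2012 Thm. 7.16 (`n = 0`) by Wuthrich 2014 Lemma 20 (`3` good ⇒ `3² ∤ N`) — so:
  **a settled `BSD(E,3)` (Wuthrich-L1: `3 ∤ #Ш_an`, 234 ‖ 59 pairs `N < 2·10⁴`; the descent-closed core
  pairs of `X8DescentRecords`) gives Sprung's Main Conj. 7.21 for `L♯_3(E)` AND for `L♭_3(E)` at the
  pair**, granted (K•) and Thm. 7.16 as displayed; conversely the typed rank-`0` residue of X8 IS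
  Main Conj. 7.21 for the (unique) real pair.

References: [Sprung2017] Thm. 1.12, Cor. 4.11 (table); [Sprung2012] Thms. 7.14, 7.16, Prop. 7.19,
Main Conj. 7.21, Def. 7.9/7.11, Open Problem 7.22 (pp. 1503–1505); [Sprung2024] Lemmas 5.5–5.9
(pp. 40–41), Rem. 5.4; [GreenbergVatsal2000] §3 Rem. 3.4; [Mazur1978] Cor. 4.1; [Wuthrich2014]
Lemma 20, Prop. 21; [Serre1972] Props. 12, 21; [Miller2011LMS] Def. 1.1.
Memo: `HOME/b2b-bsdres-additive-p3/X8-ROUTE-B.md` §9 (gen 4).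
-/

set_option autoImplicit false

noncomputable section

open scoped Classical MatrixGroups ModularForm

open CongruenceSubgroup WeierstrassCurve Literature.NumberTheory.EllipticCurves
  Literature.NumberTheory.EllipticCurves.ModularForms
  Literature.NumberTheory.EllipticCurves.Rank1Residual
  Literature.NumberTheory.EllipticCurves.Rank1Residual.Typed
  Literature.NumberTheory.EllipticCurves.Sprung2017
  Summit.BirchSwinnertonDyer.Rank1Residual.X1.MuLambda

namespace Summit.BirchSwinnertonDyer.Rank1Residual.Supersingular

/-! ### Unit normalisation of the real `L^•` -/

section UnitNormalisation

variable (W : WeierstrassCurve ℚ) [W.IsElliptic] [W.IsGloballyMinimal] (p : ℕ) [Fact p.Prime]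

omit [W.IsElliptic] [W.IsGloballyMinimal] in
/-- An integer prime to `p` has `p`-adic norm `1`. [folklore] -/
private theorem norm_intCast_eq_one_of_not_dvd {c : ℤ} (hc : ¬ (p : ℤ) ∣ c) :
    ‖(c : ℚ_[p])‖ = 1 :=
  le_antisymm (Padic.norm_int_le_one c) (not_lt.mp (mt Padic.norm_intCast_lt_one_iff.mp hc))

/-- **Unit normalisation of Sprung's real `L^•` to a datum with interpolation constant `1`.** Let
`p` be an odd prime of good reduction of `E = W`, `f` the newform of `E` (`IsNewformOf W f`) with the
period comparison `Ω_E = u · Ω⁺_f`, `|u|_p = 1` (displayed: `hΩ`; in print Greenberg–Vatsal 2000 §3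
Rem. 3.4 with the Manin constant prime to `p` — the tree's named facts
`realPeriodRat_eq_unit_mul_plusPeriod(_three)` at an irreducible `p`), `(L♯, L♭)` a Sprung pair for
`a_p(E)` and `•` a colour with `p ∤ c_•`. Then for some `w ∈ ℤ_p^×` the datum `(ξ, w·L^•, 1)`
satisfies (P) exactly: `(w·L^•)(0) = L(E,1)/Ω_E` — by the THEOREM (P•)
`L^•(0) = c_•·L(E,1)/Ω⁺_f` (`constantCoeff_chromaticL_of_isSprungPair_of_isNewformOf`), with
`w = (c_• u)⁻¹`. [cite: Sprung2017, Cor. 4.11 (table of special values)]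
[cite: GreenbergVatsal2000, §3, Remark 3.4] -/
theorem exists_units_interpolation_chromaticL
    (hp : p ≠ 2) (hgood : W.HasGoodReductionAtPrime p)
    {N : ℕ} [NeZero N] {f : CuspForm (Gamma0 N) 2} (hf : IsNewformOf W f)
    (hΩ : ∃ u : ℚ, ‖(u : ℚ_[p])‖ = 1 ∧ W.realPeriodRat = u * plusPeriod f)
    {Lsharp Lflat : IwasawaAlgebra p} (hSP : IsSprungPair f p (W.frobeniusTrace p) Lsharp Lflat)
    (c : Chroma) (hc : ¬ (p : ℤ) ∣ chromaticConst p (W.frobeniusTrace p) c) (ξ : IwasawaAlgebra p) :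
    ∃ w : ℤ_[p]ˣ, (⟨ξ, PowerSeries.C (w : ℤ_[p]) * chromaticL c Lsharp Lflat, 1⟩ :
      SignedDatum W p).Interpolation := by
  obtain ⟨u, hu, hΩu⟩ := hΩ
  have hΩf : 0 < plusPeriod f := IsNewform0.plusPeriod_pos_holds hf.1 hf.coeffField_eq_bot
  have hu0 : (u : ℚ_[p]) ≠ 0 := by
    intro h0
    rw [h0, norm_zero] at hu
    exact zero_ne_one hu
  have hu0' : u ≠ 0 := by
    rintro rfl
    exact hu0 (by push_cast; rfl)
  have hcc1 : ‖(chromaticConst p (W.frobeniusTrace p) c : ℚ_[p])‖ = 1 :=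
    norm_intCast_eq_one_of_not_dvd p hc
  have hcc0 : (chromaticConst p (W.frobeniusTrace p) c : ℚ_[p]) ≠ 0 := by
    intro h0
    rw [h0, norm_zero] at hcc1
    exact zero_ne_one hcc1
  -- `t = [0]⁺_f / u = L(E,1)/Ω_E`
  have ht : W.entireLFunction 1 / (W.realPeriodRat : ℂ) = (((ratPlusSymbol f 0 / u : ℚ)) : ℂ) := by
    rw [hf.entireLFunction_one_eq, hΩu]
    have hΩC : (plusPeriod f : ℂ) ≠ 0 := Complex.ofReal_ne_zero.mpr hΩf.ne'
    have huC : ((u : ℝ) : ℂ) ≠ 0 := by exact_mod_cast hu0'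
    push_cast
    field_simp
  -- `w = (c u)⁻¹ ∈ ℤ_p^×`
  have hnorm : ‖((chromaticConst p (W.frobeniusTrace p) c : ℚ_[p]) * (u : ℚ_[p]))⁻¹‖ = 1 := by
    rw [norm_inv, norm_mul, hcc1, hu, mul_one, inv_one]
  refine ⟨PadicInt.mkUnits hnorm, ratPlusSymbol f 0 / u, ht, ?_⟩
  show ((PowerSeries.constantCoeff (PowerSeries.C ((PadicInt.mkUnits hnorm : ℤ_[p]ˣ) : ℤ_[p]) *
      chromaticL c Lsharp Lflat) : ℤ_[p]) : ℚ_[p]) =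
    ((1 : ℕ) : ℚ_[p]) * (((ratPlusSymbol f 0 / u : ℚ)) : ℚ_[p])
  rw [map_mul, PowerSeries.constantCoeff_C, PadicInt.coe_mul, PadicInt.mkUnits_eq,
    constantCoeff_chromaticL_of_isSprungPair_of_isNewformOf hp hf hgood hSP c]
  push_cast
  field_simp

end UnitNormalisation

/-! ### Rank zero, exact form, with the real `L^•` -/

section Converse

variable (W : WeierstrassCurve ℚ) [W.IsElliptic] [W.IsGloballyMinimal] (p : ℕ) [Fact p.Prime]

/-- **Rank zero, exact form on the real `L^•`: with integral Kato divisibility, `BSD(E,p) ⟺ (ξ) =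
(L^•)`.** Let `p` be an odd good prime of `E = W` with `E[p]` irreducible and `L(E,1) ≠ 0`; `f` the
newform with `Ω_E = u·Ω⁺_f`, `|u|_p = 1` (displayed `hΩ`); `(L♯, L♭)` ANY Sprung pair for `a_p(E)`
(unique: `Sprung2017.IsSprungPair.unique`), `•` a colour with `p ∤ c_•`. Displayed binders on the
SELMER side (objects not in the tree): `ξ ∈ Λ` with the Euler-characteristic identity (K•)
`ξ(0) ∼ #Sel_{p^∞}(E/ℚ)·∏c_ℓ` (Sprung 2024 Lemmas 5.5–5.9) and the INTEGRAL Kato divisibility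
`ξ ∣ L^•` (Sprung 2012 Thm. 7.16, `n = 0` under `p`-adic surjectivity). CONCLUSION:
`BSDp W p ↔ (ξ) = (L^•)` — Main Conj. 7.21 for the datum. Proof: unit-normalise `L^•` to a
`c = 1` datum (`exists_units_interpolation_chromaticL`) and apply gen 2's
`SignedDatum.bsdp_iff_charIdealEq_of_analyticRank_eq_zero`; `(w·L^•) = (L^•)`. PER PAIR; nothing
asserted beyond the binders. [cite: Sprung2012, Thm. 7.16 and Main Conj. 7.21 (pp. 1504–1505)]
[cite: Sprung2024, Lemmas 5.5–5.9 (pp. 40–41)] [cite: Sprung2017, Thm. 1.12 and Cor. 4.11]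
[cite: Miller2011LMS, Def. 1.1] -/
theorem bsdp_iff_span_eq_span_chromaticL_of_analyticRank_eq_zero
    (hGZK : rank_eq_analyticRank_of_analyticRank_le_one)
    (hp : p ≠ 2) (hgood : W.HasGoodReductionAtPrime p)
    (hirr : W.HasIrreducibleModPGaloisRep p) (hL : W.entireLFunction 1 ≠ 0)
    {N : ℕ} [NeZero N] {f : CuspForm (Gamma0 N) 2} (hf : IsNewformOf W f)
    (hΩ : ∃ u : ℚ, ‖(u : ℚ_[p])‖ = 1 ∧ W.realPeriodRat = u * plusPeriod f)
    {Lsharp Lflat : IwasawaAlgebra p} (hSP : IsSprungPair f p (W.frobeniusTrace p) Lsharp Lflat)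
    (c : Chroma) (hc : ¬ (p : ℤ) ∣ chromaticConst p (W.frobeniusTrace p) c)
    (ξ : IwasawaAlgebra p) (hK : (⟨ξ, 0, 0⟩ : SignedDatum W p).EulerCharacteristic)
    (hU : ξ ∣ chromaticL c Lsharp Lflat) :
    BSDp W p ↔ Ideal.span ({ξ} : Set (IwasawaAlgebra p)) = Ideal.span {chromaticL c Lsharp Lflat} := by
  have hpP : p.Prime := Fact.out
  obtain ⟨w, hP⟩ := exists_units_interpolation_chromaticL W p hp hgood hf hΩ hSP c hc ξ
  have hiff := SignedDatum.bsdp_iff_charIdealEq_of_analyticRank_eq_zero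
    (⟨ξ, PowerSeries.C ((w : ℤ_[p]ˣ) : ℤ_[p]) * chromaticL c Lsharp Lflat, 1⟩ : SignedDatum W p)
    hGZK hirr hL hpP.not_dvd_one hK hP (dvd_mul_of_dvd_right hU _)
  refine hiff.trans ?_
  show Ideal.span ({ξ} : Set (IwasawaAlgebra p)) =
      Ideal.span {PowerSeries.C ((w : ℤ_[p]ˣ) : ℤ_[p]) * chromaticL c Lsharp Lflat} ↔ _
  rw [(span_C_units_mul_eq w (chromaticL c Lsharp Lflat)).1]

end Converse

/-! ### X8 readings (per pair; NOT class theorems) -/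

section X8

variable (W : WeierstrassCurve ℚ) [W.IsElliptic] [W.IsGloballyMinimal] (p : ℕ) [Fact p.Prime]

/-- **X8 ∧ `r_an = 0` ∧ surj(3): `BSD(E,3) ⟺` Sprung's Main Conj. 7.21 at the pair for the REAL
`L^•_3(E)`**, EITHER colour. Automatic / named on the class: `3 ∤ c_•` for both colours
(`ClassX8.not_dvd_chromaticConst'`), `E[3]` irreducible (`ClassX8.irr'`, Serre Prop. 12), the period
unit at `3` (`h3` = `realPeriodRat_eq_unit_mul_plusPeriod_three`: Mazur 1978 Cor. 4.1 + GV Rem.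
3.4), `3`-adic surjectivity from `ρ̄_{E,3}` onto (`hL20` = Wuthrich 2014 Lemma 20; `3` good ⇒
`3² ∤ N`), `L(E,1) ≠ 0` from `r_an = 0` (`hmod`), GZK (`hGZK`). Displayed (Selmer side, objects
absent): `ξ` with (K•) and Sprung 2012 Thm. 7.16's integral divisibility under `3`-adic surjectivity
(`hKato`). For `f` the newform and ANY (= the unique) Sprung pair. PER PAIR.
[cite: Sprung2012, Thm. 7.16, Prop. 7.19 and Main Conj. 7.21 (pp. 1504–1505)]
[cite: Sprung2024, Lemmas 5.5–5.9 (pp. 40–41)] [cite: Wuthrich2014, Lemma 20 (p. 399)]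
[cite: Mazur1978, Cor. 4.1] [cite: Serre1972, §1.11 Prop. 12] [cite: Miller2011LMS, Def. 1.1] -/
theorem X8.bsdp_iff_span_eq_span_chromaticL_of_analyticRank_eq_zero
    (h3 : realPeriodRat_eq_unit_mul_plusPeriod_three)
    (hL20 : Wuthrich2014.lemma20_surjective_threeAdic_of_semistable)
    (hGZK : rank_eq_analyticRank_of_analyticRank_le_one) (hmod : hasEntireLFunction_rat)
    (hX : ClassX8 W p) (hs : Surj W p) (h0 : W.analyticRank = 0)
    {N : ℕ} [NeZero N] {f : CuspForm (Gamma0 N) 2} (hf : IsNewformOf W f)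
    {Lsharp Lflat : IwasawaAlgebra p} (hSP : IsSprungPair f p (W.frobeniusTrace p) Lsharp Lflat)
    (c : Chroma) (ξ : IwasawaAlgebra p) (hK : (⟨ξ, 0, 0⟩ : SignedDatum W p).EulerCharacteristic)
    (hKato : (∀ n : ℕ, W.HasSurjectiveModNGaloisRep (p ^ n : ℕ)) → ξ ∣ chromaticL c Lsharp Lflat) :
    BSDp W p ↔ Ideal.span ({ξ} : Set (IwasawaAlgebra p)) = Ideal.span {chromaticL c Lsharp Lflat} := by
  have hL : W.entireLFunction 1 ≠ 0 := (W.analyticRank_eq_zero_iff_holds (hmod W)).1 h0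
  have hirr : W.HasIrreducibleModPGaloisRep p := ClassX8.irr' W p hX
  have hc := ClassX8.not_dvd_chromaticConst' W p hX c
  obtain ⟨hp3, hss, -⟩ := hX
  subst hp3
  have hgood : W.HasGoodReductionAtPrime 3 := hss.1
  exact bsdp_iff_span_eq_span_chromaticL_of_analyticRank_eq_zero W 3 hGZK (by decide) hgood hirr hL
    hf (h3 W hgood hirr f hf) hSP c hc ξ hK
    (hKato (surjective_pow_of_surj_of_good W 3 hL20 (by decide) hgood hs))

/-- **X8 ∩ {sst} ∧ `r_an = 0`**: the same with surjectivity of `ρ̄_{E,3}` automatic for semistable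
`E` (`ClassX8.surj_of_semistable`, Serre 1972 §5.4 Prop. 21 i)). PER PAIR.
[cite: Serre1972, §5.4 Prop. 21 i)] [cite: Sprung2012, Thm. 7.16 and Main Conj. 7.21 (pp. 1504–1505)]
[cite: Sprung2024, Lemmas 5.5–5.9 (pp. 40–41)] [cite: Miller2011LMS, Def. 1.1] -/
theorem X8.bsdp_iff_span_eq_span_chromaticL_of_semistable_of_analyticRank_eq_zero
    (h3 : realPeriodRat_eq_unit_mul_plusPeriod_three)
    (hL20 : Wuthrich2014.lemma20_surjective_threeAdic_of_semistable)
    (hGZK : rank_eq_analyticRank_of_analyticRank_le_one) (hmod : hasEntireLFunction_rat)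
    (hX : ClassX8 W p) (hsst : Semistable W) (h0 : W.analyticRank = 0)
    {N : ℕ} [NeZero N] {f : CuspForm (Gamma0 N) 2} (hf : IsNewformOf W f)
    {Lsharp Lflat : IwasawaAlgebra p} (hSP : IsSprungPair f p (W.frobeniusTrace p) Lsharp Lflat)
    (c : Chroma) (ξ : IwasawaAlgebra p) (hK : (⟨ξ, 0, 0⟩ : SignedDatum W p).EulerCharacteristic)
    (hKato : (∀ n : ℕ, W.HasSurjectiveModNGaloisRep (p ^ n : ℕ)) → ξ ∣ chromaticL c Lsharp Lflat) :
    BSDp W p ↔ Ideal.span ({ξ} : Set (IwasawaAlgebra p)) = Ideal.span {chromaticL c Lsharp Lflat} := by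
  have hs : Surj W p := by
    have hp3 : p = 3 := hX.1
    subst hp3
    exact ClassX8.surj_of_semistable W 3 hX hsst
  exact X8.bsdp_iff_span_eq_span_chromaticL_of_analyticRank_eq_zero W p h3 hL20 hGZK hmod hX hs h0 hf
    hSP c ξ hK hKato

/-- **X8 ∧ `r_an = 0` ∧ surj(3): a SETTLED `BSD(E,3)` gives Sprung's main conjecture at the pair for
BOTH colours of the real pair** — for every colour `•` and every `ξ` carrying (K•) and the integral
Kato divisibility for that colour, `(ξ) = (L^•_3(E))` (both `L^♯(0), L^♭(0) ≠ 0` in rank `0`,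
Sprung 2024 Rem. 5.4). Kernel instance of what the ♯/♭ main conjecture asserts, at every rank-`0` X8
pair the cell has closed from PUBLISHED inputs (Wuthrich-L1; `X8DescentRecords`). PER PAIR; closes
nothing by itself. [cite: Sprung2012, Prop. 7.19 and Main Conj. 7.21 (p. 1505)]
[cite: Sprung2024, Remark 5.4 (p. 39) and Lemmas 5.5–5.9] [cite: Wuthrich2014, Lemma 20 (p. 399) and Prop. 21 (p. 400)] -/
theorem X8.span_eq_span_chromaticL_of_bsdp_of_analyticRank_eq_zero
    (h3 : realPeriodRat_eq_unit_mul_plusPeriod_three)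
    (hL20 : Wuthrich2014.lemma20_surjective_threeAdic_of_semistable)
    (hGZK : rank_eq_analyticRank_of_analyticRank_le_one) (hmod : hasEntireLFunction_rat)
    (hX : ClassX8 W p) (hs : Surj W p) (h0 : W.analyticRank = 0) (hB : BSDp W p)
    {N : ℕ} [NeZero N] {f : CuspForm (Gamma0 N) 2} (hf : IsNewformOf W f)
    {Lsharp Lflat : IwasawaAlgebra p} (hSP : IsSprungPair f p (W.frobeniusTrace p) Lsharp Lflat)
    (c : Chroma) (ξ : IwasawaAlgebra p) (hK : (⟨ξ, 0, 0⟩ : SignedDatum W p).EulerCharacteristic)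
    (hKato : (∀ n : ℕ, W.HasSurjectiveModNGaloisRep (p ^ n : ℕ)) → ξ ∣ chromaticL c Lsharp Lflat) :
    Ideal.span ({ξ} : Set (IwasawaAlgebra p)) = Ideal.span {chromaticL c Lsharp Lflat} :=
  (X8.bsdp_iff_span_eq_span_chromaticL_of_analyticRank_eq_zero W p h3 hL20 hGZK hmod hX hs h0 hf hSP c
    ξ hK hKato).mp hB

end X8

end Summit.BirchSwinnertonDyer.Rank1Residual.Supersingular

end
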